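import Literature.Computation.FiniteGraph.IsingCorrelationCert
import Literature.Computation.FiniteGraph.PolyCert
import HarnessLib

/-!
# Finite-graph witness engine, X: uniform-coupling Ising correlations as polynomials in
# `t = tanh β`; all-coupling product-inequality certificates

Topic `Literature/Computation/FiniteGraph`; everything proved, no facts. Parts I–II evaluate the
tree's pair-ferromagnet expectation `gksExpect univ K C σ_A` (Friedli–Velenik 2017, §3.8.1) at ONE
rational bond parameter `tanh Kᵢ = aᵢ/bᵢ`. When all bonds carry the same coupling `β` (repetitions of
a bond allowed, so integer multiples `kβ` are covered), the high-temperature form (3.44) makes the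
numerator `Z·⟨σ_A⟩ / cosh(β)^m = Σ_ω σ_A(ω) ∏_{(u,v) ∈ E} (1 + t σ_u σ_v)` a POLYNOMIAL in `t = tanh β`
with integer coefficients, and `∏_{(u,v)} (1 + t σ_u σ_v) = (1+t)^k (1−t)^{m−k}` where `k` is the
number of satisfied bonds of `ω`. This file provides

* `satCount`, `oneHot`, `isingHist n E A : List ℤ` — the histogram `h_k = Σ_{ω : k(ω) = k} σ_A(ω)`
  in ONE pass over the `2^n` configurations (`cfgSumL` of part II; `2^n · m` integer operations per
  monomial — measured in the kernel, whole certificate files: `n = 10`, `m = 13`, eight monomials,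
  depth 3: 16 s; `n = 12`, `m = 17` (the `3 × 4` grid), four monomials, depth 3: 33 s);
* `bern k l = (1+t)^k (1−t)^l`, `histPolyFrom`, **`isingPoly n E A : List ℚ`** — the numerator
  polynomial `N_A(t) = Σ_k h_k (1+t)^k (1−t)^{m−k}` as a coefficient list for part V's arithmetic and
  sign certificates (`peval`, `pmul`, `posCert`);
* the BRIDGE **`gksExpect_uniform_eq`**: for bonds `E` on `Fin n` (`edgesLt n E`: endpoints `< n`,
  distinct) and ANY real `β`,
  `gksExpect univ (fun _ => β) (edgeBonds n E _) (listSpin xs) = peval (isingPoly n E xs) (tanh β) / peval (isingPoly n E []) (tanh β)`,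
  with `peval (isingPoly n E []) (tanh β) > 0` (`peval_isingPoly_nil_pos`);
* the CERTIFICATE **`prod_gksExpect_lt_of_ipCertCheck`**: if `ipCertCheck n E lhs rhs d lo hi` accepts
  (bonds well formed, `|lhs| = |rhs|`, and part V's sign certificate of depth `d` accepts
  `Π_{B ∈ rhs} N_B − Π_{A ∈ lhs} N_A` on `[lo, hi]`), then for EVERY coupling `β` with
  `tanh β ∈ [lo, hi]`: `Π_{A ∈ lhs} ⟨σ_A⟩_β < Π_{B ∈ rhs} ⟨σ_B⟩_β` (pad the shorter side with the empty
  monomial, `⟨σ_∅⟩ = 1`). One `decide +kernel` thus certifies a correlation inequality — or its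
  reversal — on a whole interval of temperatures, e.g. GKS/Lebowitz/interlacing-type comparisons of
  products of two- and four-point functions on a given finite graph (the generator
  `kit/fgwe/fgwe.py ising polycert` finds `d` and prints the Lean file).

Design as in parts I–II (structural recursion, integers inside the configuration pass; the only
rational arithmetic is the final `O(m²)` assembly). [folklore] throughout; the model and (3.44) are
Friedli–Velenik 2017, §3.7.3–§3.8.1.

## References
* S. Friedli, Y. Velenik, *Statistical Mechanics of Lattice Systems*, CUP 2017, §3.7.3 eq. (3.44),
  §3.8.1 [FriedliVelenik2017].
-/

namespace Literature.Computation.FiniteGraph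

open Finset Literature.Probability.LatticeModels

/-! ### The satisfied-bond count and the signed histogram -/

/-- The number of listed bonds `(u, v)` with `σ_u = σ_v` (i.e. `σ_u σ_v = +1`) in the configuration
coded by `c`. [folklore] -/
def satCount (c : ℕ) : List (ℕ × ℕ) → ℕ
  | [] => 0
  | e :: E => (if spinZ c e.1 = spinZ c e.2 then 1 else 0) + satCount c E

/-- At most all bonds are satisfied. [folklore] -/
theorem satCount_le_length (c : ℕ) : ∀ E : List (ℕ × ℕ), satCount c E ≤ E.length
  | [] => le_rfl
  | e :: E => by
      rw [satCount, List.length_cons]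
      have := satCount_le_length c E
      split_ifs <;> omega

/-- The integer list with `v` at index `k` and zeros before it. [folklore] -/
def oneHot : ℕ → ℤ → List ℤ
  | 0, v => [v]
  | k + 1, v => 0 :: oneHot k v

/-- **The signed histogram** `h_k = Σ_{c : satCount c E = k} σ_mono(c)`, `k = 0, …, |E|`, in one pass
over the `2^n` configuration codes. [folklore] -/
def isingHist (n : ℕ) (E : List (ℕ × ℕ)) (mono : List ℕ) : List ℤ :=
  cfgSumL (fun c => oneHot (satCount c E) (monoProdZ c mono)) n 0

/-- The evaluation functional of a histogram placed at offset `k`: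
`histEval h m k t = Σ_i h_i (1+t)^{k+i} (1−t)^{m−(k+i)}`. [folklore] -/
def histEval : List ℤ → ℕ → ℕ → ℝ → ℝ
  | [], _, _, _ => 0
  | a :: h, m, k, t => (a : ℝ) * ((1 + t) ^ k * (1 - t) ^ (m - k)) + histEval h m (k + 1) t

/-- `histEval` is additive under `addL`. [folklore] -/
theorem histEval_addL (m : ℕ) (t : ℝ) :
    ∀ (xs ys : List ℤ) (k : ℕ), histEval (addL xs ys) m k t = histEval xs m k t + histEval ys m k t
  | [], ys, k => by simp [addL, histEval]
  | x :: xs, [], k => by simp [addL, histEval]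
  | x :: xs, y :: ys, k => by
      rw [addL, histEval, histEval, histEval, histEval_addL m t xs ys (k + 1)]
      push_cast
      ring

/-- `histEval` of a list-valued configuration sum is the sum of the `histEval`s. [folklore] -/
theorem histEval_cfgSumL (f : ℕ → List ℤ) (m k : ℕ) (t : ℝ) :
    ∀ j c : ℕ, histEval (cfgSumL f j c) m k t = ∑ i ∈ range (2 ^ j), histEval (f (c * 2 ^ j + i)) m k t
  | 0, c => by simp [cfgSumL]
  | j + 1, c => by
      rw [cfgSumL, histEval_addL, histEval_cfgSumL f m k t j, histEval_cfgSumL f m k t j, pow_succ, mul_two,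
        Finset.sum_range_add]
      congr 1
      · refine Finset.sum_congr rfl fun i _ => ?_
        congr 2; ring
      · refine Finset.sum_congr rfl fun i _ => ?_
        congr 2; ring

/-- `histEval` of a one-hot list is one term. [folklore] -/
theorem histEval_oneHot (m : ℕ) (t : ℝ) (v : ℤ) :
    ∀ k k₀ : ℕ, histEval (oneHot k v) m k₀ t = (v : ℝ) * ((1 + t) ^ (k₀ + k) * (1 - t) ^ (m - (k₀ + k)))
  | 0, k₀ => by simp [oneHot, histEval]
  | k + 1, k₀ => by
      rw [oneHot, histEval, histEval_oneHot m t v k (k₀ + 1), show k₀ + 1 + k = k₀ + (k + 1) by omega]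
      push_cast
      ring

/-! ### The polynomial of a histogram -/

/-- Powers of a coefficient list. [folklore] -/
def ppow (p : List ℚ) : ℕ → List ℚ
  | 0 => [1]
  | k + 1 => pmul p (ppow p k)

/-- [folklore] -/
theorem peval_ppow (p : List ℚ) (x : ℝ) : ∀ k : ℕ, peval (ppow p k) x = peval p x ^ k
  | 0 => by simp [ppow]
  | k + 1 => by rw [ppow, peval_pmul, peval_ppow p x k, pow_succ]; ring

/-- `bern k l`: the coefficient list of `(1+t)^k (1−t)^l`. [folklore] -/
def bern (k l : ℕ) : List ℚ := pmul (ppow [1, 1] k) (ppow [1, -1] l)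

/-- [folklore] -/
theorem peval_bern (k l : ℕ) (t : ℝ) : peval (bern k l) t = (1 + t) ^ k * (1 - t) ^ l := by
  rw [bern, peval_pmul, peval_ppow, peval_ppow]
  simp only [peval_cons, peval_nil]
  push_cast
  ring

/-- The coefficient list of `Σ_i h_i (1+t)^{k+i} (1−t)^{m−(k+i)}` (histogram `h` placed at offset `k`).
[folklore] -/
def histPolyFrom (m : ℕ) : List ℤ → ℕ → List ℚ
  | [], _ => []
  | a :: h, k => padd (psmul (a : ℚ) (bern k (m - k))) (histPolyFrom m h (k + 1))

/-- `histPolyFrom` evaluates to `histEval`. [folklore] -/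
theorem peval_histPolyFrom (m : ℕ) (t : ℝ) : ∀ (h : List ℤ) (k : ℕ), peval (histPolyFrom m h k) t = histEval h m k t
  | [], k => by simp [histPolyFrom, histEval]
  | a :: h, k => by
      rw [histPolyFrom, peval_padd, peval_psmul, peval_bern, peval_histPolyFrom m t h (k + 1), histEval]
      push_cast
      ring

/-- **The numerator polynomial** `N_mono(t) = Σ_c σ_mono(c) ∏_{(u,v) ∈ E} (1 + t σ_u σ_v)` of the
uniform-coupling pair model on `Fin n` with bonds `E`, as a rational coefficient list (low degree
first; `N_[] = Z(t)·2^0`, the partition polynomial). [cite: FriedliVelenik2017, §3.7.3 eq. (3.44)] -/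
def isingPoly (n : ℕ) (E : List (ℕ × ℕ)) (mono : List ℕ) : List ℚ :=
  histPolyFrom E.length (isingHist n E mono) 0

/-- `spinZ` takes the values `±1`. [folklore] -/
theorem spinZ_eq_one_or (c i : ℕ) : spinZ c i = 1 ∨ spinZ c i = -1 := by
  unfold spinZ; split_ifs <;> simp

/-- **The bond factors of one configuration multiply to `(1+t)^k (1−t)^{m−k}`**, `k = satCount`.
[cite: FriedliVelenik2017, §3.7.3 eq. (3.44)] -/
theorem prod_bondFactor_eq (c : ℕ) (t : ℝ) : ∀ E : List (ℕ × ℕ),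
    (E.map fun e => 1 + t * ((spinZ c e.1 * spinZ c e.2 : ℤ) : ℝ)).prod =
      (1 + t) ^ satCount c E * (1 - t) ^ (E.length - satCount c E)
  | [] => by simp [satCount]
  | e :: E => by
      rw [List.map_cons, List.prod_cons, prod_bondFactor_eq c t E, satCount, List.length_cons]
      have hs := satCount_le_length c E
      by_cases h : spinZ c e.1 = spinZ c e.2
      · have hp : ((spinZ c e.1 * spinZ c e.2 : ℤ) : ℝ) = 1 := by
          rcases spinZ_eq_one_or c e.2 with h2 | h2 <;> simp [h, h2]
        rw [hp, if_pos h, show 1 + satCount c E = satCount c E + 1 by omega,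
          show E.length + 1 - (satCount c E + 1) = E.length - satCount c E by omega, pow_succ]
        ring
      · have hp : ((spinZ c e.1 * spinZ c e.2 : ℤ) : ℝ) = -1 := by
          rcases spinZ_eq_one_or c e.1 with h1 | h1 <;> rcases spinZ_eq_one_or c e.2 with h2 | h2 <;>
            simp_all
        rw [hp, if_neg h, zero_add, show E.length + 1 - satCount c E = E.length - satCount c E + 1 by omega,
          pow_succ]
        ring

/-- **The configuration sum as a polynomial value**:
`Σ_{c<2^n} σ_mono(c) · (1+t)^{k_c} (1−t)^{m−k_c} = peval (isingPoly n E mono) t`. [folklore] -/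
theorem sum_monoProdZ_mul_eq_peval (n : ℕ) (E : List (ℕ × ℕ)) (mono : List ℕ) (t : ℝ) :
    ∑ c ∈ range (2 ^ n), ((monoProdZ c mono : ℤ) : ℝ) *
        ((1 + t) ^ satCount c E * (1 - t) ^ (E.length - satCount c E)) = peval (isingPoly n E mono) t := by
  rw [isingPoly, peval_histPolyFrom, isingHist, histEval_cfgSumL]
  refine Finset.sum_congr rfl fun c _ => ?_
  rw [zero_mul, zero_add, histEval_oneHot, zero_add]

/-! ### The bridge to `gksExpect` with a uniform coupling -/

/-- Well-formed bonds on `n` sites: endpoints `< n` and distinct. [folklore] -/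
def edgesLt (n : ℕ) (E : List (ℕ × ℕ)) : Bool :=
  E.all fun e => decide (e.1 < n) && decide (e.2 < n) && !(e.1 == e.2)

/-- The per-bond conditions of `edgesLt`. [folklore] -/
theorem edgesLt_get {n : ℕ} {E : List (ℕ × ℕ)} (h : edgesLt n E = true) (i : Fin E.length) :
    (E.get i).1 < n ∧ (E.get i).2 < n ∧ (E.get i).1 ≠ (E.get i).2 := by
  simp only [edgesLt, List.all_eq_true, Bool.and_eq_true, decide_eq_true_eq, Bool.not_eq_true', beq_eq_false_iff_ne,
    ne_eq] at h
  obtain ⟨⟨h1, h2⟩, h3⟩ := h _ (List.get_mem E i)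
  exact ⟨h1, h2, h3⟩

/-- **The interaction sets** `Cᵢ = {uᵢ, vᵢ}` of a well-formed bond list. [folklore] -/
def edgeBonds (n : ℕ) (E : List (ℕ × ℕ)) (h : edgesLt n E = true) : Fin E.length → Finset (Fin n) :=
  fun i => {⟨(E.get i).1, (edgesLt_get h i).1⟩, ⟨(E.get i).2, (edgesLt_get h i).2.1⟩}

/-- The interaction sets have two elements. [folklore] -/
theorem card_edgeBonds {n : ℕ} {E : List (ℕ × ℕ)} (h : edgesLt n E = true) (i : Fin E.length) :
    (edgeBonds n E h i).card = 2 :=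
  Finset.card_pair fun heq => (edgesLt_get h i).2.2 (congrArg Fin.val heq)

/-- The spin monomial `σ_{x₁} ⋯ σ_{x_r}` of a list of sites (repetitions allowed). [folklore] -/
def listSpin {n : ℕ} (xs : List (Fin n)) : SpinConfig (Fin n) → ℝ := fun ω => (xs.map fun x => spinAt x ω).prod

/-- [folklore] -/
@[simp] theorem listSpin_nil {n : ℕ} : listSpin ([] : List (Fin n)) = fun _ => 1 := by
  funext ω; simp [listSpin]

/-- [folklore] -/
@[simp] theorem listSpin_cons {n : ℕ} (x : Fin n) (xs : List (Fin n)) :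
    listSpin (x :: xs) = fun ω => spinAt x ω * listSpin xs ω := by
  funext ω; simp [listSpin]

/-- Two-point functions: `listSpin [p, q] = σ_p σ_q`. [folklore] -/
theorem listSpin_pair {n : ℕ} (p q : Fin n) : listSpin [p, q] = fun ω => spinAt p ω * spinAt q ω := by
  funext ω; simp [listSpin]

/-- Four-point functions. [folklore] -/
theorem listSpin_four {n : ℕ} (p q r s : Fin n) :
    listSpin [p, q, r, s] = fun ω => spinAt p ω * spinAt q ω * spinAt r ω * spinAt s ω := by
  funext ω; simp [listSpin]; ring

/-- The `gksExpect` numerator sum of the uniform model is the numerator polynomial at `t = tanh β`.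
[cite: FriedliVelenik2017, §3.8.1] -/
theorem sum_listSpin_mul_prod_eq_peval {n : ℕ} {E : List (ℕ × ℕ)} (hE : edgesLt n E = true) (β : ℝ)
    (xs : List (Fin n)) :
    ∑ c ∈ range (2 ^ n), listSpin xs (decode n c) *
        ∏ i : Fin E.length, (1 + Real.tanh β * spinProduct (edgeBonds n E hE i) (decode n c)) =
      peval (isingPoly n E (xs.map Fin.val)) (Real.tanh β) := by
  rw [← sum_monoProdZ_mul_eq_peval]
  refine Finset.sum_congr rfl fun c _ => ?_
  rw [listSpin, prod_map_spinAt_decode, ← prod_bondFactor_eq c (Real.tanh β) E, ← List.prod_ofFn]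
  congr 1
  congr 1
  apply List.ext_getElem (by simp)
  intro i h₁ h₂
  rw [List.length_ofFn] at h₁
  rw [List.getElem_ofFn, List.getElem_map]
  have huv : (⟨(E.get ⟨i, h₁⟩).1, (edgesLt_get hE ⟨i, h₁⟩).1⟩ : Fin n) ≠ ⟨(E.get ⟨i, h₁⟩).2, (edgesLt_get hE ⟨i, h₁⟩).2.1⟩ :=
    fun heq => (edgesLt_get hE ⟨i, h₁⟩).2.2 (congrArg Fin.val heq)
  simp only [edgeBonds]
  rw [spinProduct_pair_decode c huv]
  rfl

/-- **The partition polynomial is positive at `t = tanh β`** (every factor `1 ± tanh β` is positive).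
[folklore] -/
theorem peval_isingPoly_nil_pos {n : ℕ} {E : List (ℕ × ℕ)} (hE : edgesLt n E = true) (β : ℝ) :
    0 < peval (isingPoly n E []) (Real.tanh β) := by
  have h := sum_listSpin_mul_prod_eq_peval hE β []
  simp only [List.map_nil, listSpin_nil, one_mul] at h
  rw [← h]
  refine Finset.sum_pos (fun c _ => Finset.prod_pos fun i _ => ?_) ⟨0, by simp⟩
  have ht1 : Real.tanh β < 1 := Real.tanh_lt_one β
  have ht2 : -1 < Real.tanh β := Real.neg_one_lt_tanh β
  rcases spinProduct_eq_one_or (edgeBonds n E hE i) (decode n c) with hs | hs <;> rw [hs] <;> linarith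

/-- **The bridge (uniform coupling).** For well-formed bonds `E` on `Fin n`, every real `β` and every
spin monomial, `⟨σ_{x₁}⋯σ_{x_r}⟩_β = N_xs(tanh β) / N_[](tanh β)`. [cite: FriedliVelenik2017, §3.8.1] -/
theorem gksExpect_uniform_eq {n : ℕ} {E : List (ℕ × ℕ)} (hE : edgesLt n E = true) (β : ℝ) (xs : List (Fin n)) :
    gksExpect Finset.univ (fun _ : Fin E.length => β) (edgeBonds n E hE) (listSpin xs) =
      peval (isingPoly n E (xs.map Fin.val)) (Real.tanh β) / peval (isingPoly n E []) (Real.tanh β) := by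
  rw [gksExpect_eq_sum_div_sum, sum_listSpin_mul_prod_eq_peval hE β xs]
  have h := sum_listSpin_mul_prod_eq_peval hE β []
  simp only [List.map_nil, listSpin_nil, one_mul] at h
  rw [h]

/-! ### The all-coupling product certificate -/

/-- The product of the numerator polynomials of a list of monomials. [folklore] -/
def prodPoly (n : ℕ) (E : List (ℕ × ℕ)) : List (List ℕ) → List ℚ
  | [] => [1]
  | A :: L => pmul (isingPoly n E A) (prodPoly n E L)

/-- [folklore] -/
theorem peval_prodPoly (n : ℕ) (E : List (ℕ × ℕ)) (t : ℝ) :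
    ∀ L : List (List ℕ), peval (prodPoly n E L) t = (L.map fun A => peval (isingPoly n E A) t).prod
  | [] => by simp [prodPoly, peval]
  | A :: L => by rw [prodPoly, peval_pmul, peval_prodPoly n E t L, List.map_cons, List.prod_cons]

/-- **The certificate checker**: bonds well formed, as many monomials on both sides, and the sign
certificate of part V accepts `Π_rhs N_B − Π_lhs N_A` on `[lo, hi]` at bisection depth `d`. [folklore] -/
def ipCertCheck (n : ℕ) (E : List (ℕ × ℕ)) (lhs rhs : List (List ℕ)) (d : ℕ) (lo hi : ℚ) : Bool :=
  edgesLt n E && (lhs.length == rhs.length) && posCert (psub (prodPoly n E rhs) (prodPoly n E lhs)) d lo hi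

/-- A passing check has well-formed bonds. [folklore] -/
theorem edgesLt_of_ipCertCheck {n : ℕ} {E : List (ℕ × ℕ)} {lhs rhs : List (List ℕ)} {d : ℕ} {lo hi : ℚ}
    (h : ipCertCheck n E lhs rhs d lo hi = true) : edgesLt n E = true := by
  simp only [ipCertCheck, Bool.and_eq_true] at h
  exact h.1.1

/-- A list product of quotients with a common denominator. [folklore] -/
theorem prod_map_div_eq {α : Type*} (L : List α) (a : α → ℝ) (z : ℝ) :
    (L.map fun A => a A / z).prod = (L.map a).prod / z ^ L.length := by
  induction L with
  | nil => simp
  | cons A L ih => rw [List.map_cons, List.prod_cons, ih, List.map_cons, List.prod_cons, List.length_cons, pow_succ]; ring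

/-- **Soundness of the certificate: an all-coupling product inequality.** If the check accepts then
for every coupling `β` with `tanh β ∈ [lo, hi]`, in the pair model `K ≡ β` on the bonds `E` of `Fin n`,
`Π_{A ∈ lhs} ⟨σ_A⟩_β < Π_{B ∈ rhs} ⟨σ_B⟩_β`. [cite: FriedliVelenik2017, §3.8.1] -/
theorem prod_gksExpect_lt_of_ipCertCheck {n : ℕ} {E : List (ℕ × ℕ)} {lhs rhs : List (List (Fin n))} {d : ℕ}
    {lo hi : ℚ} (h : ipCertCheck n E (lhs.map fun A => A.map Fin.val) (rhs.map fun B => B.map Fin.val) d lo hi = true)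
    (β : ℝ) (hlo : (lo : ℝ) ≤ Real.tanh β) (hhi : Real.tanh β ≤ hi) :
    (lhs.map fun A => gksExpect Finset.univ (fun _ : Fin E.length => β)
        (edgeBonds n E (edgesLt_of_ipCertCheck h)) (listSpin A)).prod <
      (rhs.map fun B => gksExpect Finset.univ (fun _ : Fin E.length => β)
        (edgeBonds n E (edgesLt_of_ipCertCheck h)) (listSpin B)).prod := by
  have hE := edgesLt_of_ipCertCheck h
  have h' := h
  simp only [ipCertCheck, Bool.and_eq_true, beq_iff_eq, List.length_map] at h'
  obtain ⟨⟨-, hlen⟩, hcert⟩ := h'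
  have hpos := posCert_sound hcert hlo hhi
  rw [peval_psub, peval_prodPoly, peval_prodPoly, List.map_map, List.map_map] at hpos
  set z := peval (isingPoly n E []) (Real.tanh β) with hz
  have hzpos : 0 < z := peval_isingPoly_nil_pos hE β
  simp_rw [gksExpect_uniform_eq hE β]
  rw [prod_map_div_eq, prod_map_div_eq, hlen]
  apply div_lt_div_of_pos_right _ (pow_pos hzpos _)
  have e1 : (lhs.map fun A => peval (isingPoly n E (A.map Fin.val)) (Real.tanh β)) =
      lhs.map ((fun A => peval (isingPoly n E A) (Real.tanh β)) ∘ fun A => A.map Fin.val) := rfl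
  have e2 : (rhs.map fun B => peval (isingPoly n E (B.map Fin.val)) (Real.tanh β)) =
      rhs.map ((fun A => peval (isingPoly n E A) (Real.tanh β)) ∘ fun B => B.map Fin.val) := rfl
  rw [e1, e2]
  linarith

/-! ### Kernel regression examples -/

/-- Triangle: `Z(t)/1 = Σ_c ∏ (1 + t s_e) = 8 (1 + t³)` and `N_{01}(t) = 8 (t + t²)`, so
`⟨σ₀σ₁⟩ = (t + t²)/(1 + t³)` (cf. part I's `15/19` at `t = 3/5`). -/
example : isingPoly 3 [(0, 1), (1, 2), (0, 2)] [] = [8, 0, 0, 8] ∧ isingPoly 3 [(0, 1), (1, 2), (0, 2)] [0, 1] = [0, 8, 8, 0] := by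
  decide +kernel

/-- Triangle, Griffiths' second inequality `⟨σ₀σ₁⟩⟨σ₁σ₂⟩ < ⟨σ₀σ₁σ₁σ₂⟩ = ⟨σ₀σ₂⟩` made strict and
uniform on `tanh β ∈ [1/100, 1/2]` (difference `64 t (1 − t²)²`; depth `0` — the full range `[1/100, 99/100]`
needs depth `7`, the bound being crude near the double zero at `t = 1`). -/
example : ipCertCheck 3 [(0, 1), (1, 2), (0, 2)] [[0, 1], [1, 2]] [[0, 2], []] 0 (1 / 100) (1 / 2) = true := by
  decide +kernel

end Literature.Computation.FiniteGraph
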